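import Summits.QuantumFields.GaugeBoot.LoopEquationSchema
import Summits.QuantumFields.GaugeBoot.LoopEquationSU2
import Literature.MathematicalPhysics.QuantumFieldTheory.ConstructiveQFTBalabanRGStability3Proofs
import HarnessLib

/-!
# The `SU(2)` loop equation for an arbitrary closed word, in SINGLE-LOOP normal form (cell `gauge-boot`, L1 (iii))

Honest framing (cell rule): certified bounds on lattice expectations at stated coupling, gauge group, dimension and
torus size; NOT a mass gap, NOT a continuum limit, NOT a string tension; not summit-bearing
(`FixedCouplingUltralocality`, `PerturbativeInvisibility`).

`LoopEquation.lean` / `LoopEquationSchema.lean` give the single-link Schwinger–Dyson equation of a closed word `w` at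
the link `(x, μ)` with SPLIT terms `tr ρ(U_A)·tr ρ(U_B)` (products of two traces) at every traversal of the link.  For
`SU(2)` the generators (eng1 `G1`, eng2 `G2`, GLYZ2025, KZ2022) write their rows in single loops only, using the
`2 × 2` identity `tr A · tr B = tr(AB) + tr(AB⁻¹)` (`A, B ∈ SU(2)`; tree `su2_coe_add_coe_inv`: `B + B⁻¹ = (tr B)·1`)
— FANOUT-PLAN row L1 (iii).  This file performs that reduction once and for all:

* `trace_mul_trace_su_two` : `tr A · tr B = tr(AB) + tr(AB⁻¹)` in the fundamental representation of `SU(2)`;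
* `trace_split_su_two` : for a word `w` closed at `x` and a prefix `w[0,k)` closed at `x`,
  `tr U_{w[0,k)} · tr U_{w[k,n)} = tr U_w + tr U_{w[0,k) · (w[k,n))⁻¹}` (both factors are loops at `x`);
* `integral_split_su_two` : the split term integrates to `E_w + 2·E_{w[0,k)·(w[k,n))⁻¹}` in the real loop variables
  `E_v = ⟨W_x(v)⟩ = wilsonExpectation (suRep 2) β (wordLoop (suRep 2) x v)` (`W = ½ Re tr`);
* `loopEquation_su_two_loops` : **the `SU(2)` loop equation in single loops** — for `w` closed at `x` and small for
  the torus (`Word.Small`, i.e. every partial displacement `≤ L − 2`; `LoopEquationSchema`),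
  `Σ_{k : fwdOccZ} (E_w + 2 E_{w[0,k)·(w[k,n))⁻¹}) − Σ_{k : bwdOccZ} (E_w + 2 E_{w[0,k]·(w(k,n))⁻¹})`
  `+ β·Σ_{ν ≠ μ} Σ_{ε} (E_{w·P̃(ν,ε)} − E_{w·P̃(ν,ε)⁻¹}) = 0`,
  the occurrence sets being computed on `ℤ^d` (`decide`).  Dividing by nothing: this is already the `W`-normalised
  (Makeenko–Migdal) form up to the overall factor `λ = 4/β` of the generators (`c0 + c1/λ` convention of eng1's
  `leq/1` files, `λ_KZ = 2N²/β_std`, `β = β_std/2`).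
Everything is `[folklore]`.
-/

noncomputable section

open MeasureTheory
open scoped Matrix
open Literature.MathematicalPhysics.QuantumFieldTheory
open Literature.MathematicalPhysics.QuantumLattice

namespace Summit.QuantumFields.GaugeBoot

variable {d L : ℕ}

section Pointwise

/-- **`tr A · tr B = tr(AB) + tr(AB⁻¹)` on `SU(2)`** (fundamental representation; from the tree's
`su2_coe_add_coe_inv : B + B⁻¹ = (tr B)·1`). [folklore] -/
theorem trace_mul_trace_su_two (A B : Matrix.specialUnitaryGroup (Fin 2) ℂ) :
    (fundamentalRep (Fin 2) A).trace * (fundamentalRep (Fin 2) B).trace =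
      (fundamentalRep (Fin 2) (A * B)).trace + (fundamentalRep (Fin 2) (A * B⁻¹)).trace := by
  simp only [fundamentalRep_apply, Submonoid.coe_mul]
  rw [← Matrix.trace_add, ← Matrix.mul_add, su2_coe_add_coe_inv, Matrix.mul_smul, Matrix.mul_one,
    Matrix.trace_smul, smul_eq_mul, mul_comm]

variable {G : Type*} [Group G]

omit [Group G] in
/-- The integer displacement after `k + 1` letters. [folklore] -/
theorem Word.dispZ_succ_of_getElem? {w : Word d} {k : ℕ} {st : Step d} (h : w[k]? = some st) :
    w.dispZ (k + 1) = w.dispZ k + st.dispZ := by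
  unfold Word.dispZ
  rw [List.take_add_one, h]
  simp

/-- If `w` is closed at `x` and so is its prefix `w[0,k)`, then so is its suffix `w[k,n)` read from `x`. [folklore] -/
theorem Word.endpoint_drop_of_take (x : Site d L) (w : Word d) (k : ℕ) (hw : Word.endpoint x w = x)
    (hk : Word.endpoint x (w.take k) = x) : Word.endpoint x (w.drop k) = x := by
  have h := Word.endpoint_append x (w.take k) (w.drop k)
  rw [List.take_append_drop, hw, hk] at h
  exact h.symm

/-- **Split product ↦ single loops, pointwise**: for `w` closed at `x` with the prefix `w[0,k)` closed at `x`,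
`tr U_{w[0,k)} · tr U_{w[k,n)} = tr U_w + tr U_{w[0,k)·(w[k,n))⁻¹}` in the fundamental representation of `SU(2)`.
[folklore] -/
theorem trace_split_su_two (x : Site d L) (w : Word d) (k : ℕ) (hw : Word.endpoint x w = x)
    (hk : Word.siteAt x w k = x) (U : GaugeConfig d L (Matrix.specialUnitaryGroup (Fin 2) ℂ)) :
    (fundamentalRep (Fin 2) (wordHolonomy U x (w.take k))).trace *
        (fundamentalRep (Fin 2) (wordHolonomy U (Word.siteAt x w k) (w.drop k))).trace =
      (fundamentalRep (Fin 2) (wordHolonomy U x w)).trace +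
        (fundamentalRep (Fin 2) (wordHolonomy U x (w.take k ++ Word.reverse (w.drop k)))).trace := by
  have hk' : Word.endpoint x (w.take k) = x := hk
  have hdrop : Word.endpoint x (w.drop k) = x := Word.endpoint_drop_of_take x w k hw hk'
  have e1 : wordHolonomy U x w = wordHolonomy U x (w.take k) * wordHolonomy U x (w.drop k) := by
    rw [← wordHolonomy_take_drop U x w k, hk]
  have e2 : wordHolonomy U x (w.take k ++ Word.reverse (w.drop k)) =
      wordHolonomy U x (w.take k) * (wordHolonomy U x (w.drop k))⁻¹ := by
    rw [wordHolonomy_append, hk', ← wordHolonomy_reverse U x (w.drop k), hdrop]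
  rw [hk, e1, e2]
  exact trace_mul_trace_su_two _ _

end Pointwise

section Integrated

variable [NeZero L]

/-- **The split term integrates to single loop variables** (`SU(2)`): for `w` closed at `x` with `w[0,k)` closed at
`x`, `∫ (tr U_{w[0,k)} tr U_{w[k,n)} − ½ tr U_w) dμ_β = E_w + 2·E_{w[0,k)·(w[k,n))⁻¹}`. [folklore] -/
theorem integral_split_su_two (β : ℝ) (x : Site d L) (w : Word d) (k : ℕ) (hw : Word.endpoint x w = x)
    (hk : Word.siteAt x w k = x) :
    ∫ U, ((fundamentalRep (Fin 2) (wordHolonomy U x (w.take k))).trace *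
          (fundamentalRep (Fin 2) (wordHolonomy U (Word.siteAt x w k) (w.drop k))).trace -
        (1 / (2 : ℕ)) * (fundamentalRep (Fin 2) (wordHolonomy U x w)).trace)
        ∂(wilsonMeasure (d := d) (L := L) (fundamentalRep (Fin 2)) β) =
      ((wilsonExpectation (d := d) (L := L) (suRep 2) β (wordLoop (suRep 2) x w) +
          2 * wilsonExpectation (d := d) (L := L) (suRep 2) β
            (wordLoop (suRep 2) x (w.take k ++ Word.reverse (w.drop k))) : ℝ) : ℂ) := by
  simp_rw [trace_split_su_two x w k hw hk]
  have hi : ∀ v : Word d, Integrable (fun U : GaugeConfig d L (Matrix.specialUnitaryGroup (Fin 2) ℂ) =>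
      (fundamentalRep (Fin 2) (wordHolonomy U x v)).trace)
      (wilsonMeasure (d := d) (L := L) (fundamentalRep (Fin 2)) β) :=
    fun v => integrable_of_continuous (fundamentalLatticeRep 2) β
      (continuous_trace_wordHolonomy (fundamentalLatticeRep 2) x v)
  have hfun : (fun U : GaugeConfig d L (Matrix.specialUnitaryGroup (Fin 2) ℂ) =>
      (fundamentalRep (Fin 2) (wordHolonomy U x w)).trace +
          (fundamentalRep (Fin 2) (wordHolonomy U x (w.take k ++ Word.reverse (w.drop k)))).trace -
        (1 / (2 : ℕ)) * (fundamentalRep (Fin 2) (wordHolonomy U x w)).trace) =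
      fun U => (1 / (2 : ℕ) : ℂ) * (fundamentalRep (Fin 2) (wordHolonomy U x w)).trace +
        (fundamentalRep (Fin 2) (wordHolonomy U x (w.take k ++ Word.reverse (w.drop k)))).trace := by
    funext U; ring
  rw [hfun, integral_add ((hi _).const_mul _) (hi _), integral_const_mul, integral_trace_su_two_wordLoop,
    integral_trace_su_two_wordLoop]
  push_cast
  ring

/-- **THE `SU(2)` LOOP EQUATION IN SINGLE LOOPS.**  For a word `w` closed at `x` and small for the torus `(ℤ/L)^d`
(`Word.Small`: returns to `x` / to `x + e_μ` are decided on `ℤ^d`), at the link `(x, μ)`, tree coupling `β`: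
`Σ_{k ∈ fwdOccZ} (E_w + 2·E_{w[0,k)·(w[k,n))⁻¹}) − Σ_{k ∈ bwdOccZ} (E_w + 2·E_{w[0,k]·(w(k,n))⁻¹})`
`+ β·Σ_{ν ≠ μ} Σ_{ε} (E_{w·P̃(μ,ν,ε)} − E_{w·P̃(μ,ν,ε)⁻¹}) = 0`, `E_v = ⟨½ Re tr U_v⟩_β` — the generators' `SU(2)`
normal form (single traces only; FANOUT-PLAN L1 (iii)). [folklore] -/
theorem loopEquation_su_two_loops (β : ℝ) (x : Site d L) (μ : Fin d) (w : Word d)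
    (hw : Word.endpoint x w = x) (hsm : w.Small L) :
    (∑ k ∈ (Finset.range w.length).filter (w.fwdOccZ μ),
        (wilsonExpectation (d := d) (L := L) (suRep 2) β (wordLoop (suRep 2) x w) +
          2 * wilsonExpectation (d := d) (L := L) (suRep 2) β
            (wordLoop (suRep 2) x (w.take k ++ Word.reverse (w.drop k))))) -
      (∑ k ∈ (Finset.range w.length).filter (w.bwdOccZ μ),
        (wilsonExpectation (d := d) (L := L) (suRep 2) β (wordLoop (suRep 2) x w) +
          2 * wilsonExpectation (d := d) (L := L) (suRep 2) β
            (wordLoop (suRep 2) x (w.take (k + 1) ++ Word.reverse (w.drop (k + 1)))))) +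
      β * ∑ ν ∈ Finset.univ.erase μ, ∑ ε : Bool,
        (wilsonExpectation (d := d) (L := L) (suRep 2) β (wordLoop (suRep 2) x (w ++ plaqWord μ ν ε)) -
          wilsonExpectation (d := d) (L := L) (suRep 2) β
            (wordLoop (suRep 2) x (w ++ (plaqWord μ ν ε).reverse))) = 0 := by
  have h := loopEquation_schema_specialUnitaryGroup (L := L) 2 β x μ w hw hsm
  -- forward occurrences: the prefix `w[0,k)` is closed at `x`
  have hf : ∀ k ∈ (Finset.range w.length).filter (w.fwdOccZ μ), Word.siteAt x w k = x := fun k hk =>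
    (Word.siteAt_eq_iff hsm x k).2 (Finset.mem_filter.1 hk).2.2
  -- backward occurrences: the prefix `w[0,k]` is closed at `x`
  have hb : ∀ k ∈ (Finset.range w.length).filter (w.bwdOccZ μ), Word.siteAt x w (k + 1) = x := fun k hk => by
    obtain ⟨hk1, hk2⟩ := (Finset.mem_filter.1 hk).2
    refine (Word.siteAt_eq_iff hsm x (k + 1)).2 ?_
    rw [Word.dispZ_succ_of_getElem? hk1, hk2]
    ext i
    by_cases hi : i = μ
    · subst hi; simp [Step.dispZ]
    · simp [Step.dispZ, hi]
  rw [Finset.sum_congr rfl fun k hk => integral_split_su_two β x w k hw (hf k hk),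
    Finset.sum_congr rfl fun k hk => integral_split_su_two β x w (k + 1) hw (hb k hk)] at h
  simp only [integral_plaqTerm_su_two] at h
  apply Complex.ofReal_injective
  push_cast at h ⊢
  simp only [← Finset.mul_sum] at h
  linear_combination h

/-- **Small words from a displacement bound** (restated for convenience): if every partial displacement of `w` has
sup-norm `≤ B` (`Word.DispBound`, decidable) and `B + 2 ≤ L`, the word is small for `(ℤ/L)^d`, so
`loopEquation_su_two_loops` applies on every such torus. [folklore] -/
theorem loopEquation_su_two_loops_of_dispBound (β : ℝ) (x : Site d L) (μ : Fin d) (w : Word d)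
    (hw : Word.endpoint x w = x) {B : ℕ} (hB : w.DispBound B) (hL : B + 2 ≤ L) :
    (∑ k ∈ (Finset.range w.length).filter (w.fwdOccZ μ),
        (wilsonExpectation (d := d) (L := L) (suRep 2) β (wordLoop (suRep 2) x w) +
          2 * wilsonExpectation (d := d) (L := L) (suRep 2) β
            (wordLoop (suRep 2) x (w.take k ++ Word.reverse (w.drop k))))) -
      (∑ k ∈ (Finset.range w.length).filter (w.bwdOccZ μ),
        (wilsonExpectation (d := d) (L := L) (suRep 2) β (wordLoop (suRep 2) x w) +
          2 * wilsonExpectation (d := d) (L := L) (suRep 2) β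
            (wordLoop (suRep 2) x (w.take (k + 1) ++ Word.reverse (w.drop (k + 1)))))) +
      β * ∑ ν ∈ Finset.univ.erase μ, ∑ ε : Bool,
        (wilsonExpectation (d := d) (L := L) (suRep 2) β (wordLoop (suRep 2) x (w ++ plaqWord μ ν ε)) -
          wilsonExpectation (d := d) (L := L) (suRep 2) β
            (wordLoop (suRep 2) x (w ++ (plaqWord μ ν ε).reverse))) = 0 :=
  loopEquation_su_two_loops β x μ w hw (Word.small_of_dispBound hB hL)

end Integrated

end Summit.QuantumFields.GaugeBoot

end
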